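import Literature.MathematicalPhysics.QuantumFieldTheory.Balaban1983to89.T4PersistentHistoryCount
import Literature.MathematicalPhysics.QuantumFieldTheory.Balaban1983to89.T4PersistenceRenewal

/-!
# `Balaban1983to89.T4PersistenceDictionary` — THE (ID) DICTIONARY OF NE7b: Bałaban's renewal / merger / fat R-steps
as ε-EVENTS with placed windows; the three LOCATED lifetime rules typed as a GENEALOGY LEDGER and the theorem
«pending ⟹ `Covers` ⟹ span condition ⟹ record»; both NE7b carriers (`T4PersistentHistoryCount.slotDom_of_records`,
`T4PersistenceRenewal.EventDom` / `pairKernel`) instantiated on the one dictionary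
(cell `pub-balaban`, node U5c / spine estimate NE7b, carved row T4-U5c.E-NE7b-READING° of T4-DAG v17, unit
b2b-balaban-t4-ne7b-p1 gen 3 — the lineage of `T4PersistentHistoryCount`; companion record `t4/T4-XREAD-NE7b-READING.md`;
imports the two NE7b leaves ONLY and modifies nothing)

HONEST FRAMING (cell `pub-balaban`, T4-DAG PAGE 1).  The cell's T4 target is the existence AND uniqueness of the
`ε → 0` limit of Bałaban's unit-scale block-averaged expectations on a FIXED finite four-torus ([Balaban1988Convergent]
Cor. 3 p. 264, [Balaban1989LargeFieldII] Thm 1 p. 355 are ultraviolet STABILITY only) — NOT infinite volume, NOT a mass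
gap, NOT the Clay problem.  This module is [folklore] finite combinatorics (zero `sorry`, zero cite-tagged hypothesis,
no `def … : Prop` fact of Bałaban's); it uses NONE of the cell's conditionals (BetaPertH, (B), (B^μ)), which stay
binders of the consumer (they enter only through the flow `j ↦ g_j` behind the window profile `R` and the credits).
B15/B16 = [Balaban1989LargeFieldI/II] are manuscripts UNDER AUDIT: quoted below for what they STATE at the cited page
(read as images on the ×2 renders `b2b-balaban-ref1/pages/1989-cmp122-large-field-II/…-p029…p033-x2.png`, journal page =
render + 354; the same loci are certified in the cell record `t4/T4-XREAD-U5c.md` (Q11)–(Q15), GAPS C-pv05g5-1), never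
as establishing a disputed step.  Value = a READING made checkable + kernel bookkeeping; NOT an estimate, NOT summit
progress.

THE READING (ID) THIS MODULE TYPES (cell gap G-ne7bp1-2, first item; T4-DAG v17 row NE7b-READING°).  The persistence
RECORD MODEL of `T4PersistentHistoryCount` (§1 there: events `ε`, windows `W`, birth `b`, `Covers` ⟹ `SpanLE` ⟹
`records`) and the RENEWAL MODEL of `T4PersistenceRenewal` (§6–§7 there: `EventDom`, `pairKernel q W s ℓ`) are both
abstract in WHAT an event is and WHERE its window sits.  The page fixes both:
* (L1) EPOCH of a region born at step `j` with linear size `d′ = d′_j(Z)`: «Let n₀ be the last index n such that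
  d′_n(Z^{(n−j)}) > 0. Then S^{n₀+1−j}(Z) is contained in a cube of the size 64MR_{n₀+1}, hence it satisfies the condition
  (i), and doing at most R_j further steps we obtain a domain satisfying both conditions (i), (ii). Thus K ≤ n₀ − j + R_j»
  (p. 385 [R p031]), with «d′_n(Z^{(n−j)}) ≤ L^{−1/2(n−j)}d′_j(Z) ≤ 2^{−(n−j)}d′_j(Z)» stated «for n − j > 1»
  (pp. 384–385 [R p030/p031]) — so `n₀ − j ≤ max 1 ⌊log₂ d′⌋` (`fatWait`);
* (L2) RENEWAL: «the domains Z such that Z = S(Z₀), Z₀ satisfies the conditions (i), (ii), and a new large field was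
  introduced in the preparatory operations. Then κ_j(Z₀) ≥ 0, and we do not have a better bound for it, but we have the
  new factor exp(−p₀(g_j)). We define κ_{j+1}(Z) = p₀(g_j) − O(1)M^dR_{j+1}^{d+1}d′_{j+1}(Z). It satisfies (1.80), because
  Z is a small domain, it is contained in a cube of the size 100MR_{j+1}, hence K = R_{j+1} for Z.» (pp. 385–386
  [R p031/p032]) — a renewal happens AT READINESS and re-opens a window `R_{j+1}` at step `j + 1`;
* (L3) MERGER (second case, p. 386 [R p032]: «Z is obtained from some number of components of Z_j, and some number of
  new large field regions, joined together into the one component of Z_{j+1} by the operations of the last step»,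
  reduced to BINARY mergers along «a maximal tree graph», (1.86)–(1.87)): «The domains X, Y determine the corresponding
  indices K₁, K₂. … we may assume that, for example K₁ ≤ K₂. … applying n₁ times the operation S to the last domain,
  where n₁ is a rather small number, e.g., n₁ < 10, we obtain the domain S^{K₁+n₁}(Y) containing S^{K₁+n₁}(X). This
  implies that S^{n−j−1}(Z) = S^{n−j−1}(Y) for n ≥ j + 1 + K₁ + n₁, and that K ≤ K₂ + n₁ + R_{j+1}.» (p. 387 [R p033]),
  and the COST SPLIT (1.88) [R p033]: the control cost of the merged `Z` over its `K` remaining steps is bounded by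
  `X`'s cost up to `K₁ + n₁` plus `Y`'s cost up to `K₂ + n₁ + R_{j+1}`, «≤ κ_{j+1}(X) + κ_{j+1}(Y) + O(1)2(100M)^dR^{d+2}_{j+1}
  ≤ κ_{j+1}(Z) − 2(1 + β₀)^{−1}p₀(g_{j+1}) + O(1)3(100M)^dR^{d+2}_{j+1} ≤ κ_{j+1}(Z)» — the steps of the merged life up
  to the LATER partner horizon are paid by the partners' OWN banks, only the allowance `n₁ + R_{j+1}` beyond it by the
  merger surplus of (1.87).
THE DECISION THE ROW ASKED FOR (readings m1 / m2 of the cross-read l.47298): the page has ONE merger rule (L3) for both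
— a merger with a NEW region (m1) and a merger of OLD components (m2) get the same window `n₁ + R_{j+1}` DEFERRED to the
later partner horizon; they differ only in the credit source ((1.85): the new region's own factor, resp. the reserved
terms `2p₀(g_{j(X)}) + 2p₀(g_{j(Y)}) − 2p₀(g_{j(Z)}) ≥ 2(1+β₀)^{−1}p₀(g_{j+1})` of (1.86)).  CONSEQUENCE FOR THE SLOT
(the one place where a naive dictionary is WRONG, §4 decides it on a three-event example): after a merger the absorbed
partner stays pending up to the OTHER partner's horizon, and those steps are paid by the other partner's windows (1.88) —
so the record of ONE constituent does NOT satisfy the span condition; the slot whose record does is the WHOLE GENEALOGY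
of the pending component, rooted at its FIRST birth — which is print's own index: «j(Z) is the index of a first large
field region contained in Z» (p. 384 [R p030]) — with every later constituent birth, renewal and binary merger an event
of its record.

WHAT THIS MODULE PROVES ([folklore]; nothing of Bałaban's asserted):
* §1 `Chained` / `covers_of_chained`: the ledger-free principle — windows whose starts are CHAINED (each opens at or
  before the birth step, or no later than the end of a strictly earlier-starting window) and one of which ends after `K`
  cover `[j, K]` (`T4PersistentHistoryCount.Covers`), hence `SpanLE`, hence membership in `records`.
* §2 `Gen` (born / renew / merge), `Gen.reach` = the three rules (L1)–(L3) as a recursive horizon, `Gen.place` =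
  births and renewals IMMEDIATE, mergers DEFERRED to the later partner reach, `Gen.WF` = the located side conditions
  (distinct events; renewal while pending; merger partners alive together), and THE COVER THEOREM `Gen.cover` /
  `Gen.covers` / `Gen.spanLE` / `Gen.mem_records`: a well-formed genealogy pending at `K` (`K < reach`) has `[j(Z), K]`
  covered by the placed windows of its events, so its record (events other than the root birth) is a member of
  `records W j(Z) K E root` for every universe `E` containing it — the hypothesis under which `slotDom_of_records`
  charges a slot.  `Gen.chained`: the genealogy placement is chained (§1 applies too).  `Gen.renew_lag_le`,
  `Gen.merge_place_eq`: the next event always opens its window within / at the end of the window in force — the support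
  condition `ℓ ≤ W (s − ℓ)` of `T4PersistenceRenewal.pairKernel` in placement coordinates.
* §3 THE DICTIONARY: `PEv = (step, kind, fatness)`, the WINDOW TABLE `dictW R n₁` (birth `fatWait d′ + R s + 1`, renewal
  `R s + 1`, merger `n₁ + R s`; exclusive reach), the event universe `dictE` (steps `∈ (j, K]`, fatness `< Dcap K`) and
  birth kinds `dictB`; `slotDom_of_records_dict` = carrier P1 with the dictionary plugged (binder `hE` discharged, the
  WALL binders — context-uniform per-record prices, cell gap G-ne7bp1-1 — untouched); `pairKernel_live(_renew)` =
  carrier P2's kernel entry along a genealogy is the live one; and the two `example`s the row asks for: both carriers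
  land in the SAME `T4WeightBudget.RelWeightBound` shape `1 − exp(−C·V·r^{K − j⋆K + 1}/(1 − r))` on the same run data
  (P1: `r = Λ·e^{η̄ − κ₁}`, `C = ρ̄·e^{−κ₁}`; P2: `r = Λ·z⁻¹`, `C = B₀D/η`).
* §4 sanity, decided: the merged genealogy `merge (born 0 0) (born 1 1) 2` on windows `3, 4, 2` (reach `7`), its cover
  and span at `K = 6`, and THE MERGER GAP — the root constituent's own record `{2}` fails the span condition.
WHERE THE KERNEL IS STRONGER THAN THE PAGE (flagged, all harmless for an UPPER bound or hypotheses WEAKER than print):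
`records` ⊇ realisable genealogies (all subsets with the span condition); `WF` lets a renewal happen at any pending step
(print: at readiness) and lets partners merge whenever their lives overlap (print: both domains of step `j + 1`); the
ledger books the printed upper bounds for `K` as the reach; the universe `dictE` caps the fatness by `Dcap K` (finite
torus) and takes steps in `(j, K]` (a constituent co-born at the root step is re-labelled to `j + 1`, its true window
start `j` being inside the root window).  NOT KERNEL, NOT PRINTED (the wall, unchanged): that the credits (1.79) /
«exp(−p₀(g_j))» / (1.87) FUND these windows in a bound RELATIVE to the context, uniformly (cell rows E2-rel, R1;
`slotDom_of_records`' `hdom`, `EventDom`'s `child` / root budget).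
-/

open Finset

namespace Literature.MathematicalPhysics.QuantumFieldTheory.Balaban1983to89.T4PersistenceDictionary

open Literature.MathematicalPhysics.QuantumFieldTheory.Balaban1983to89
open T4WeightBudget T4HistoryPeeling T4PersistentHistoryCount T4PersistenceRenewal

/-! ## §1 Chained placements cover: the ledger-free form of «pending ⟹ `Covers`» -/

section Chain

variable {ε : Type*}

/-- **CHAINED PLACEMENT.**  A placement `a` of the windows `W` of a finite set `S` of events is CHAINED to the birth step
`j` iff every window starts at or before `j`, or starts no later than the END of a window that starts strictly earlier
(«the new epoch opens while an older one is still in force, or immediately when it closes»).  This is the one property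
the three printed lifetime rules have in common (epoch from the birth «K ≤ n₀ − j + R_j» p. 385: start `= j`; renewal
«hence K = R_{j+1} for Z» p. 386: start = the step after the old horizon; merger «K ≤ K₂ + n₁ + R_{j+1}» p. 387: start =
the step after the later partner horizon). [folklore] -/
def Chained (W a : ε → ℕ) (j : ℕ) (S : Finset ε) : Prop :=
  ∀ e ∈ S, a e ≤ j ∨ ∃ e' ∈ S, a e' < a e ∧ a e ≤ a e' + W e'

/-- **CHAINED WINDOWS REACHING BEYOND `K` COVER THE LIFE `[j, K]`** (`T4PersistentHistoryCount.Covers`): if the placement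
is chained to `j` and some window ends after `K`, every step of `[j, K]` lies in a window.  Proof: among the windows
ending after `x` take one with the earliest start; if it started after `x` it would be chained to a strictly earlier
window also ending after `x`. [folklore] -/
theorem covers_of_chained [DecidableEq ε] {W a : ε → ℕ} {j K : ℕ} {b : ε} {Q : Finset ε}
    (hch : Chained W a j (insert b Q)) (hK : ∃ e ∈ insert b Q, K < a e + W e) : Covers W j K b Q a := by
  intro x hx
  rw [Finset.mem_Icc] at hx
  set S := (insert b Q).filter (fun e => x < a e + W e) with hS
  have hne : S.Nonempty := by
    obtain ⟨e, he, hKe⟩ := hK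
    exact ⟨e, Finset.mem_filter.2 ⟨he, lt_of_le_of_lt hx.2 hKe⟩⟩
  obtain ⟨e₀, he₀, hmin⟩ := S.exists_min_image a hne
  obtain ⟨he₀S, hxe₀⟩ := Finset.mem_filter.1 he₀
  refine ⟨e₀, he₀S, ?_, hxe₀⟩
  by_contra hlt
  push Not at hlt
  rcases hch e₀ he₀S with hj | ⟨e', he', hlt', hle'⟩
  · omega
  · have he'S : e' ∈ S := Finset.mem_filter.2 ⟨he', by omega⟩
    have := hmin e' he'S
    omega

/-- … hence the span condition, and membership in the record space over any universe containing the events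
(`spanLE_of_covers`, `mem_records`). [folklore] -/
theorem spanLE_of_chained [DecidableEq ε] {W a : ε → ℕ} {j K : ℕ} {b : ε} {Q : Finset ε}
    (hch : Chained W a j (insert b Q)) (hK : ∃ e ∈ insert b Q, K < a e + W e) (hb : b ∉ Q) :
    SpanLE W j K b Q :=
  spanLE_of_covers (covers_of_chained hch hK) hb

/-- … and so the record `Q` of a chained pending slot is a member of `records`. [folklore] -/
theorem mem_records_of_chained [DecidableEq ε] {W a : ε → ℕ} {j K : ℕ} {b : ε} {Q E : Finset ε}
    (hch : Chained W a j (insert b Q)) (hK : ∃ e ∈ insert b Q, K < a e + W e) (hb : b ∉ Q) (hE : Q ⊆ E) :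
    Q ∈ records W j K E b :=
  mem_records.2 ⟨hE, spanLE_of_chained hch hK hb⟩

end Chain

/-! ## §2 The genealogy ledger: the three located lifetime rules, typed, imply the window cover -/

section Genealogy

variable {ε : Type*}

/-- **THE GENEALOGY OF A PENDING COMPONENT** (the merger tree of a component of Bałaban's large-field region, as DATA;
READING (ID) of B16 pp. 384–387, nothing asserted): `born b j` — a large-field region created at step `j` with birth
event `b` (its (1.79) factor p. 381/383; epoch «K ≤ n₀ − j + R_j» p. 385); `renew G e h` — the component `G`, ready for
the R-operation at step `h` (conditions (i), (ii)), acquires a new large field in the preparatory operations: event `e`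
at step `h + 1` with the fresh factor «exp(−p₀(g_j))» and «K = R_{j+1} for Z» (p. 386); `merge X Y e` — the BINARY
merger of two pending components into one (second case p. 386, (1.84)–(1.88); a merger of several old components and
new regions is a chain of binary ones along a maximal tree, as in print p. 386), event `e` carrying the surplus
«2(1 + β₀)^{−1}p₀(g_{j+1})» of (1.87) and the window «K ≤ K₂ + n₁ + R_{j+1}» of p. 387.  An m1-merger (with a NEW region)
is `merge X (born b' x) e`; an m2-merger (two OLD components) is `merge X Y e` with both `X`, `Y` composite. [folklore] -/
inductive Gen (ε : Type*) : Type _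
  | born (b : ε) (j : ℕ) : Gen ε
  | renew (G : Gen ε) (e : ε) (h : ℕ) : Gen ε
  | merge (X Y : Gen ε) (e : ε) : Gen ε

namespace Gen

/-- The ROOT BIRTH STEP `j(Z)`: «j(Z) is the index of a first large field region contained in Z» (p. 384) — the
earliest birth among the constituents. [folklore] -/
def rootStep : Gen ε → ℕ
  | born _ j => j
  | renew G _ _ => G.rootStep
  | merge X Y _ => min X.rootStep Y.rootStep

/-- The ROOT BIRTH EVENT (a constituent born at `rootStep`; ties resolved towards the first partner). [folklore] -/
def root : Gen ε → ε
  | born b _ => b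
  | renew G _ _ => G.root
  | merge X Y _ => if X.rootStep ≤ Y.rootStep then X.root else Y.root

/-- The LAST EVENT of the genealogy (the birth itself for a bare region). [folklore] -/
def top : Gen ε → ε
  | born b _ => b
  | renew _ e _ => e
  | merge _ _ e => e

/-- **THE REACH** (exclusive horizon: the first step at which the component is no longer pending if no further event
occurs), computed from the event windows `W` by the three printed rules: birth `j + W b` («K ≤ n₀ − j + R_j» p. 385 —
`W b` = fat waiting time + `R_j` + 1); renewal at readiness step `h`: `h + 1 + W e` («hence K = R_{j+1} for Z» p. 386 —
`W e = R_{h+1} + 1`); merger: `max (reach X) (reach Y) + W e` («K ≤ K₂ + n₁ + R_{j+1}» p. 387, `K₂` the later partner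
index — `W e = n₁ + R`).  Print states upper bounds for the index `K`; the ledger books the bound. [folklore] -/
def reach (W : ε → ℕ) : Gen ε → ℕ
  | born b j => j + W b
  | renew _ e h => h + 1 + W e
  | merge X Y e => max (X.reach W) (Y.reach W) + W e

/-- root step of a bare birth [folklore] -/
@[simp] theorem rootStep_born (b : ε) (j : ℕ) : (born b j).rootStep = j := rfl
/-- a renewal keeps the root step [folklore] -/
@[simp] theorem rootStep_renew (G : Gen ε) (e : ε) (h : ℕ) : (renew G e h).rootStep = G.rootStep := rfl
/-- the root step of a merger is the earlier partner root step [folklore] -/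
@[simp] theorem rootStep_merge (X Y : Gen ε) (e : ε) :
    (merge X Y e).rootStep = min X.rootStep Y.rootStep := rfl
/-- reach of a bare birth: rule (L1) [folklore] -/
@[simp] theorem reach_born (W : ε → ℕ) (b : ε) (j : ℕ) : (born b j).reach W = j + W b := rfl
/-- reach after a renewal: rule (L2) [folklore] -/
@[simp] theorem reach_renew (W : ε → ℕ) (G : Gen ε) (e : ε) (h : ℕ) : (renew G e h).reach W = h + 1 + W e := rfl
/-- reach after a merger: rule (L3) [folklore] -/
@[simp] theorem reach_merge (W : ε → ℕ) (X Y : Gen ε) (e : ε) :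
    (merge X Y e).reach W = max (X.reach W) (Y.reach W) + W e := rfl
/-- last event of a bare birth [folklore] -/
@[simp] theorem top_born (b : ε) (j : ℕ) : (born b j).top = b := rfl
/-- last event after a renewal [folklore] -/
@[simp] theorem top_renew (G : Gen ε) (e : ε) (h : ℕ) : (renew G e h).top = e := rfl
/-- last event after a merger [folklore] -/
@[simp] theorem top_merge (X Y : Gen ε) (e : ε) : (merge X Y e).top = e := rfl

variable [DecidableEq ε]

/-- All events of the genealogy (births of every constituent, renewals, mergers). [folklore] -/
def events : Gen ε → Finset ε
  | born b _ => {b}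
  | renew G e _ => insert e G.events
  | merge X Y e => insert e (X.events ∪ Y.events)

/-- **THE PLACEMENT** of each event's window: births at their step, renewals at the step `h + 1` at which the renewed
component appears (IMMEDIATE), mergers at the later partner reach (DEFERRED — the merger window pays only for the steps
beyond both partners' horizons, exactly as (1.88) p. 387 splits the cost of the merged component between `κ_{j+1}(X)`,
`κ_{j+1}(Y)` and the surplus). [folklore] -/
def place (W : ε → ℕ) : Gen ε → ε → ℕ
  | born _ j => fun _ => j
  | renew G e h => fun e' => if e' = e then h + 1 else G.place W e'
  | merge X Y e => fun e' =>
      if e' = e then max (X.reach W) (Y.reach W) else if e' ∈ X.events then X.place W e' else Y.place W e'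

/-- **WELL-FORMEDNESS** = the located side conditions: events are distinct; a renewal happens while the component is
pending (`rootStep ≤ h < reach` — in print exactly at readiness, `h + 1 = reach`, p. 386; the ledger allows earlier);
the two partners of a merger are alive together (their lives `[rootStep, reach)` overlap — in print both are domains of
the same step `j + 1`, p. 386–387). [folklore] -/
def WF (W : ε → ℕ) : Gen ε → Prop
  | born _ _ => True
  | renew G e h => G.WF W ∧ e ∉ G.events ∧ G.rootStep ≤ h ∧ h < G.reach W
  | merge X Y e => X.WF W ∧ Y.WF W ∧ e ∉ X.events ∧ e ∉ Y.events ∧ Disjoint X.events Y.events ∧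
      X.rootStep < Y.reach W ∧ Y.rootStep < X.reach W

/-- events of a bare birth [folklore] -/
@[simp] theorem events_born (b : ε) (j : ℕ) : (born b j).events = {b} := rfl
/-- events after a renewal [folklore] -/
@[simp] theorem events_renew (G : Gen ε) (e : ε) (h : ℕ) : (renew G e h).events = insert e G.events := rfl
/-- events after a merger [folklore] -/
@[simp] theorem events_merge (X Y : Gen ε) (e : ε) : (merge X Y e).events = insert e (X.events ∪ Y.events) := rfl
/-- placement in a bare birth [folklore] -/
@[simp] theorem place_born (W : ε → ℕ) (b : ε) (j : ℕ) (e' : ε) : (born b j).place W e' = j := rfl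
/-- placement after a renewal (equation) [folklore] -/
theorem place_renew (W : ε → ℕ) (G : Gen ε) (e : ε) (h : ℕ) (e' : ε) :
    (renew G e h).place W e' = if e' = e then h + 1 else G.place W e' := rfl
/-- placement after a merger (equation) [folklore] -/
theorem place_merge (W : ε → ℕ) (X Y : Gen ε) (e e' : ε) :
    (merge X Y e).place W e' =
      if e' = e then max (X.reach W) (Y.reach W) else if e' ∈ X.events then X.place W e' else Y.place W e' := rfl

/-- The renewal window is IMMEDIATE: placed at the step the renewed component appears. [folklore] -/
@[simp] theorem place_renew_self (W : ε → ℕ) (G : Gen ε) (e : ε) (h : ℕ) : (renew G e h).place W e = h + 1 := by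
  simp [place_renew]

/-- The merger window is DEFERRED to the later partner reach («K ≤ K₂ + n₁ + R_{j+1}», `K₂` the larger index, p. 387).
[folklore] -/
@[simp] theorem place_merge_self (W : ε → ℕ) (X Y : Gen ε) (e : ε) :
    (merge X Y e).place W e = max (X.reach W) (Y.reach W) := by
  simp [place_merge]

/-- The root birth is an event; so is the last event. [folklore] -/
theorem root_mem : ∀ G : Gen ε, G.root ∈ G.events
  | born b j => by simp [root]
  | renew G e h => by simpa [root] using Or.inr G.root_mem
  | merge X Y e => by
      unfold root
      split_ifs
      · simp [X.root_mem]
      · simp [Y.root_mem]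

/-- The last event is an event. [folklore] -/
theorem top_mem : ∀ G : Gen ε, G.top ∈ G.events
  | born b j => by simp
  | renew G e h => by simp
  | merge X Y e => by simp

/-- The reach is the end of the last event's window (so the next event, renewal or merger, is chained to it). [folklore] -/
theorem reach_eq_place_top (W : ε → ℕ) : ∀ G : Gen ε, G.reach W = G.place W G.top + W G.top
  | born b j => rfl
  | renew G e h => by simp
  | merge X Y e => by simp

/-- The root step is at most every placement (windows never start before the first birth). [folklore] -/
theorem rootStep_le_place (W : ε → ℕ) : ∀ G : Gen ε, G.WF W → ∀ e ∈ G.events, G.rootStep ≤ G.place W e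
  | born b j, _, e, _ => le_rfl
  | renew G e h, hW, e', he' => by
      simp only [WF] at hW
      obtain ⟨hG, _, hh, _⟩ := hW
      rw [place_renew]
      split_ifs with h1
      · simp; omega
      · rw [events_renew, Finset.mem_insert] at he'
        exact G.rootStep_le_place W hG e' (he'.resolve_left h1)
  | merge X Y e, hW, e', he' => by
      simp only [WF] at hW
      obtain ⟨hX, hY, _, _, _, hXY, hYX⟩ := hW
      have hmY := le_max_right (X.reach W) (Y.reach W)
      have hmin₁ := min_le_left X.rootStep Y.rootStep
      rw [place_merge, rootStep_merge]
      split_ifs with h1 h2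
      · omega
      · exact (min_le_left _ _).trans (X.rootStep_le_place W hX e' h2)
      · rw [events_merge, Finset.mem_insert, Finset.mem_union] at he'
        have he'Y : e' ∈ Y.events := by tauto
        exact (min_le_right _ _).trans (Y.rootStep_le_place W hY e' he'Y)

/-- **THE COVER THEOREM OF THE LEDGER.**  In a well-formed genealogy every step of the life `[rootStep, reach)` lies in
the placed window of one of its events.  Induction over the three rules: a bare region is covered by its epoch; a
renewal extends the cover from the old reach by the fresh window; a merger is covered up to the later partner reach by
the two partners' own events (their lives overlap, so no gap) and beyond it by the deferred merger window — the typed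
form of the cost split (1.88) p. 387. [folklore] -/
theorem cover (W : ε → ℕ) :
    ∀ G : Gen ε, G.WF W → ∀ x, G.rootStep ≤ x → x < G.reach W →
      ∃ e ∈ G.events, G.place W e ≤ x ∧ x < G.place W e + W e
  | born b j, _, x, h1, h2 => ⟨b, by simp, by simpa using h1, by simpa using h2⟩
  | renew G e h, hW, x, h1, h2 => by
      simp only [WF] at hW
      obtain ⟨hG, he, hh, hhr⟩ := hW
      rw [rootStep_renew] at h1
      rw [reach_renew] at h2
      by_cases hx : x ≤ h
      · obtain ⟨e', he', h3, h4⟩ := G.cover W hG x h1 (lt_of_le_of_lt hx hhr)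
        have hne : e' ≠ e := fun heq => he (heq ▸ he')
        exact ⟨e', by simp [he'], by simp [place_renew, hne, h3], by simp [place_renew, hne, h4]⟩
      · exact ⟨e, by simp, by simp; omega, by simp; omega⟩
  | merge X Y e, hW, x, h1, h2 => by
      simp only [WF] at hW
      obtain ⟨hX, hY, heX, heY, hXY, hXr, hYr⟩ := hW
      have hmX := le_max_left (X.reach W) (Y.reach W)
      have hmY := le_max_right (X.reach W) (Y.reach W)
      rw [rootStep_merge] at h1
      rw [reach_merge] at h2
      by_cases hx : x < max (X.reach W) (Y.reach W)
      · by_cases hxX : X.rootStep ≤ x ∧ x < X.reach W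
        · obtain ⟨e', he', h3, h4⟩ := X.cover W hX x hxX.1 hxX.2
          have hne : e' ≠ e := fun heq => heX (heq ▸ he')
          refine ⟨e', by simp [he'], ?_, ?_⟩
          · simp [place_merge, hne, he', h3]
          · simp [place_merge, hne, he', h4]
        · have hxY : Y.rootStep ≤ x ∧ x < Y.reach W := by
            rw [not_and_or, not_le, not_lt] at hxX
            rcases hxX with hlt | hge
            · constructor
              · have := min_le_iff.1 h1; omega
              · omega
            · constructor
              · omega
              · have := lt_max_iff.1 hx; omega
          obtain ⟨e', he', h3, h4⟩ := Y.cover W hY x hxY.1 hxY.2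
          have hne : e' ≠ e := fun heq => heY (heq ▸ he')
          have hnX : e' ∉ X.events := fun h' => Finset.disjoint_left.1 hXY h' he'
          refine ⟨e', by simp [he'], ?_, ?_⟩
          · simp [place_merge, hne, hnX, h3]
          · simp [place_merge, hne, hnX, h4]
      · exact ⟨e, by simp, by simp; omega, by simp; omega⟩

/-- **PENDING AT `K` ⟹ `Covers`** (cell gap G-ne7bp1-2, first item, now kernel OVER THE THREE LOCATED RULES): a
well-formed genealogy still pending at step `K` (`K < reach`) has its life `[rootStep, K]` covered by the placed windows
of its root birth and of its other events. [folklore] -/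
theorem covers {W : ε → ℕ} {G : Gen ε} (hG : G.WF W) {K : ℕ} (hK : K < G.reach W) :
    Covers W G.rootStep K G.root (G.events.erase G.root) (G.place W) := by
  intro x hx
  rw [Finset.mem_Icc] at hx
  obtain ⟨e, he, h1, h2⟩ := G.cover W hG x hx.1 (lt_of_le_of_lt hx.2 hK)
  refine ⟨e, ?_, h1, h2⟩
  rw [Finset.insert_erase G.root_mem]
  exact he

/-- … hence the SPAN CONDITION `K + 1 − rootStep ≤ W root + Σ_{other events} W e` … [folklore] -/
theorem spanLE {W : ε → ℕ} {G : Gen ε} (hG : G.WF W) {K : ℕ} (hK : K < G.reach W) :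
    SpanLE W G.rootStep K G.root (G.events.erase G.root) :=
  spanLE_of_covers (G.covers hG hK) (by simp)

/-- … and the record of the genealogy (its events other than the root birth) is a member of
`T4PersistentHistoryCount.records` over every event universe containing it — the hypothesis under which
`slotDom_of_records` charges a pending slot. [folklore] -/
theorem mem_records {W : ε → ℕ} {G : Gen ε} (hG : G.WF W) {K : ℕ} (hK : K < G.reach W) {E : Finset ε}
    (hE : G.events.erase G.root ⊆ E) : G.events.erase G.root ∈ records W G.rootStep K E G.root :=
  T4PersistentHistoryCount.mem_records.2 ⟨hE, G.spanLE hG hK⟩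

/-- The genealogy's placement is CHAINED to its root step (§1): every window not starting at or before the root
step starts no later than the end of a strictly earlier-starting one.  (Placements need not lie below the final reach —
an early renewal with a short window lowers the reach — so this is proved along the construction, not from the final
cover.) [folklore] -/
theorem chained (W : ε → ℕ) : ∀ G : Gen ε, G.WF W → Chained W (G.place W) G.rootStep G.events
  | born b j, _ => fun e _ => Or.inl le_rfl
  | renew G e h, hW => by
      simp only [WF] at hW
      obtain ⟨hG, he, hh, hhr⟩ := hW
      intro e' he'
      rw [events_renew, Finset.mem_insert] at he'
      rcases eq_or_ne e' e with heq | hne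
      · subst heq
        right
        obtain ⟨e'', he'', h1, h2⟩ := G.cover W hG h hh hhr
        have hne'' : e'' ≠ e' := fun hq => he (hq ▸ he'')
        refine ⟨e'', by simp [he''], ?_, ?_⟩
        · simp [place_renew, hne'']; omega
        · simp [place_renew, hne'']; omega
      · have he'G : e' ∈ G.events := he'.resolve_left hne
        rcases G.chained W hG e' he'G with h0 | ⟨e'', he'', h1, h2⟩
        · left; simpa [place_renew, hne] using h0
        · right
          have hne'' : e'' ≠ e := fun hq => he (hq ▸ he'')
          refine ⟨e'', by simp [he''], ?_, ?_⟩
          · simpa [place_renew, hne, hne''] using h1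
          · simpa [place_renew, hne, hne''] using h2
  | merge X Y e, hW => by
      simp only [WF] at hW
      obtain ⟨hX, hY, heX, heY, hXY, hXr, hYr⟩ := hW
      intro e' he'
      have hmX := le_max_left (X.reach W) (Y.reach W)
      have hmY := le_max_right (X.reach W) (Y.reach W)
      have hmin₁ := min_le_left X.rootStep Y.rootStep
      have hmin₂ := min_le_right X.rootStep Y.rootStep
      -- a window of `X` (resp. `Y`) starting after the root step is chained inside `X` or to a window of `Y` (resp. …)
      have caseX : ∀ e' ∈ X.events, (merge X Y e).place W e' = X.place W e' →
          (merge X Y e).place W e' ≤ min X.rootStep Y.rootStep ∨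
            ∃ e'' ∈ (merge X Y e).events, (merge X Y e).place W e'' < (merge X Y e).place W e' ∧
              (merge X Y e).place W e' ≤ (merge X Y e).place W e'' + W e'' := by
        intro e' he' hpl
        rw [hpl]
        rcases X.chained W hX e' he' with h0 | ⟨e'', he'', h1, h2⟩
        · by_cases hle : X.place W e' ≤ min X.rootStep Y.rootStep
          · exact Or.inl hle
          · right
            push Not at hle
            -- then `Y.rootStep < X.place e' ≤ X.rootStep < Y.reach`: the step before is covered by `Y`
            have hYs : Y.rootStep ≤ X.place W e' - 1 := by
              rcases min_lt_iff.1 hle with h' | h' <;> omega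
            have hYr' : X.place W e' - 1 < Y.reach W := by omega
            obtain ⟨e'', he'', h1, h2⟩ := Y.cover W hY _ hYs hYr'
            have hne'' : e'' ≠ e := fun hq => heY (hq ▸ he'')
            have hnX : e'' ∉ X.events := fun h' => Finset.disjoint_left.1 hXY h' he''
            refine ⟨e'', by simp [he''], ?_, ?_⟩
            · simp [place_merge, hne'', hnX]; omega
            · simp [place_merge, hne'', hnX]; omega
        · right
          have hne'' : e'' ≠ e := fun hq => heX (hq ▸ he'')
          refine ⟨e'', by simp [he''], ?_, ?_⟩
          · simpa [place_merge, hne'', he''] using h1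
          · simpa [place_merge, hne'', he''] using h2
      have caseY : ∀ e' ∈ Y.events, (merge X Y e).place W e' = Y.place W e' →
          (merge X Y e).place W e' ≤ min X.rootStep Y.rootStep ∨
            ∃ e'' ∈ (merge X Y e).events, (merge X Y e).place W e'' < (merge X Y e).place W e' ∧
              (merge X Y e).place W e' ≤ (merge X Y e).place W e'' + W e'' := by
        intro e' he' hpl
        rw [hpl]
        rcases Y.chained W hY e' he' with h0 | ⟨e'', he'', h1, h2⟩
        · by_cases hle : Y.place W e' ≤ min X.rootStep Y.rootStep
          · exact Or.inl hle
          · right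
            push Not at hle
            have hXs : X.rootStep ≤ Y.place W e' - 1 := by
              rcases min_lt_iff.1 hle with h' | h' <;> omega
            have hXr' : Y.place W e' - 1 < X.reach W := by omega
            obtain ⟨e'', he'', h1, h2⟩ := X.cover W hX _ hXs hXr'
            have hne'' : e'' ≠ e := fun hq => heX (hq ▸ he'')
            refine ⟨e'', by simp [he''], ?_, ?_⟩
            · simp [place_merge, hne'', he'']; omega
            · simp [place_merge, hne'', he'']; omega
        · right
          have hne'' : e'' ≠ e := fun hq => heY (hq ▸ he'')
          have hnX : e'' ∉ X.events := fun h' => Finset.disjoint_left.1 hXY h' he''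
          refine ⟨e'', by simp [he''], ?_, ?_⟩
          · simpa [place_merge, hne'', hnX] using h1
          · simpa [place_merge, hne'', hnX] using h2
      rcases eq_or_ne e' e with heq | hne
      · -- the merger window: opens at the later reach, i.e. right after a covered step (or at step 0)
        subst heq
        by_cases hm : max (X.reach W) (Y.reach W) ≤ min X.rootStep Y.rootStep
        · exact Or.inl (by simpa [place_merge] using hm)
        · right
          push Not at hm
          rcases le_total (Y.reach W) (X.reach W) with hle | hle
          · -- `X` reaches further: the step before the merger window is covered by `X`
            have hmx : max (X.reach W) (Y.reach W) = X.reach W := max_eq_left hle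
            have h1 : X.rootStep ≤ X.reach W - 1 := by omega
            have h2 : X.reach W - 1 < X.reach W := by omega
            obtain ⟨e'', he'', h3, h4⟩ := X.cover W hX _ h1 h2
            have hne'' : e'' ≠ e' := fun hq => heX (hq ▸ he'')
            refine ⟨e'', by simp [he''], ?_, ?_⟩
            · simp [place_merge, hne'', he'']; omega
            · simp [place_merge, hne'', he'']; omega
          · have hmx : max (X.reach W) (Y.reach W) = Y.reach W := max_eq_right hle
            have h1 : Y.rootStep ≤ Y.reach W - 1 := by omega
            have h2 : Y.reach W - 1 < Y.reach W := by omega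
            obtain ⟨e'', he'', h3, h4⟩ := Y.cover W hY _ h1 h2
            have hne'' : e'' ≠ e' := fun hq => heY (hq ▸ he'')
            have hnX : e'' ∉ X.events := fun h' => Finset.disjoint_left.1 hXY h' he''
            refine ⟨e'', by simp [he''], ?_, ?_⟩
            · simp [place_merge, hne'', hnX]; omega
            · simp [place_merge, hne'', hnX]; omega
      · rw [events_merge, Finset.mem_insert, Finset.mem_union] at he'
        rcases he'.resolve_left hne with heX' | heY'
        · exact caseX e' heX' (by simp [place_merge, hne, heX'])
        · have hnX : e' ∉ X.events := fun h' => Finset.disjoint_left.1 hXY h' heY'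
          exact caseY e' heY' (by simp [place_merge, hne, hnX])

/-- **THE RENEWAL LAG FITS THE WINDOW OF THE EVENT IN FORCE** (the support condition `ℓ ≤ W (s − ℓ)` of
`T4PersistenceRenewal.pairKernel`, in placement coordinates): a renewal at readiness step `h` opens its window at
`h + 1 ≤ reach G = place top + W top`, i.e. the lag from the last event's window start is at most that window.
[folklore] -/
theorem renew_lag_le (W : ε → ℕ) {G : Gen ε} {e : ε} {h : ℕ} (hW : (renew G e h).WF W) :
    (h + 1) - G.place W G.top ≤ W G.top := by
  simp only [WF] at hW
  obtain ⟨_, _, _, hhr⟩ := hW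
  rw [G.reach_eq_place_top W] at hhr
  omega

/-- Likewise the deferred merger window opens exactly at the end of the later partner's last window. [folklore] -/
theorem merge_place_eq (W : ε → ℕ) (X Y : Gen ε) (e : ε) :
    (merge X Y e).place W e = max (X.place W X.top + W X.top) (Y.place W Y.top + W Y.top) := by
  rw [place_merge_self, X.reach_eq_place_top, Y.reach_eq_place_top]

end Gen

end Genealogy

/-! ## §3 The dictionary: persistence events, the window table, and both NE7b carriers on it -/

section Dictionary

/-- **PERSISTENCE EVENTS** of the dictionary: `(step, kind, fatness class d′)` with kind `0` = BIRTH of a large-field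
region (its «fundamental large field factor» (1.77) p. 381 / the middle product of (1.79) p. 383 — a NEW region
`Z^{(i)}_{j+1}` joining a pending component at a merger (reading m1) is such a birth), kind `1` = RENEWAL (the product
`Π′ exp(−p₀(g_j))` of (1.79): «components of Z_j satisfying the conditions (i), (ii), for which some large fields are
created during the preparatory steps» p. 383; «hence K = R_{j+1} for Z» p. 386), kind `2` = BINARY MERGER (second case
p. 386, (1.84)–(1.88); surplus (1.87), window «K ≤ K₂ + n₁ + R_{j+1}» p. 387). [folklore] -/
abbrev PEv : Type := ℕ × Fin 3 × ℕ

namespace PEv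

/-- the step of the event [folklore] -/
def step (e : PEv) : ℕ := e.1

/-- the kind of the event (`0` birth, `1` renewal, `2` merger) [folklore] -/
def kind (e : PEv) : Fin 3 := e.2.1

/-- the fatness class `d′` (linear size in `M R`-cubes, p. 381) — relevant for births [folklore] -/
def fat (e : PEv) : ℕ := e.2.2

/-- step of a triple [folklore] -/
@[simp] theorem step_mk (s : ℕ) (k : Fin 3) (d : ℕ) : step (s, k, d) = s := rfl
/-- kind of a triple [folklore] -/
@[simp] theorem kind_mk (s : ℕ) (k : Fin 3) (d : ℕ) : kind (s, k, d) = k := rfl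
/-- fatness of a triple [folklore] -/
@[simp] theorem fat_mk (s : ℕ) (k : Fin 3) (d : ℕ) : fat (s, k, d) = d := rfl

end PEv

/-- **THE FAT WAITING TIME** `n₀ − j` of a region of fatness `d′` before its images `S^{n−j}(Z)` become small
(condition (i)): from «d′_n(Z^{(n−j)}) ≤ L^{−1/2(n−j)}d′_j(Z) ≤ 2^{−(n−j)}d′_j(Z)», stated «for n − j > 1» (pp. 384–385),
`d′_n(Z^{(n−j)}) = 0` as soon as `n − j ≥ max 2 (⌊log₂ d′⌋ + 1)`, so `n₀ − j ≤ max 1 ⌊log₂ d′⌋` — the `max 1` is the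
printed qualifier «for n − j > 1» (cross-read advisory D2, C-pv18g12-1). READING of the printed geometry, [folklore]
arithmetic. -/
def fatWait (d : ℕ) : ℕ := max 1 (Nat.log 2 d)

/-- **THE WINDOW TABLE** (exclusive reach; `R s` = the (2.5)-window `R_s` of the run at step `s`, `n₁` the merger
allowance «n₁ is a rather small number, e.g., n₁ < 10» p. 387): birth at `s` of fatness `d′` ↦ `fatWait d′ + R s + 1`
(«Thus K ≤ n₀ − j + R_j» p. 385: pending on `[j, j + K]`); renewal at `s` ↦ `R s + 1` («hence K = R_{j+1} for Z»
p. 386, `s = j + 1` the step at which the renewed component appears); merger at `s` ↦ `n₁ + R s`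
(«K ≤ K₂ + n₁ + R_{j+1}» p. 387, the window beyond the later partner reach).  A READING (ID) — the page states
upper bounds for the index `K`, the table books them. [folklore] -/
def dictW (R : ℕ → ℕ) (n₁ : ℕ) (e : PEv) : ℕ :=
  if e.kind = 0 then fatWait e.fat + R e.step + 1 else if e.kind = 1 then R e.step + 1 else n₁ + R e.step

/-- window of a birth event [folklore] -/
@[simp] theorem dictW_birth (R : ℕ → ℕ) (n₁ s d : ℕ) : dictW R n₁ (s, 0, d) = fatWait d + R s + 1 := by
  simp [dictW]

/-- window of a renewal event [folklore] -/
@[simp] theorem dictW_renew (R : ℕ → ℕ) (n₁ s d : ℕ) : dictW R n₁ (s, 1, d) = R s + 1 := by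
  simp [dictW]

/-- window of a merger event [folklore] -/
@[simp] theorem dictW_merge (R : ℕ → ℕ) (n₁ s d : ℕ) : dictW R n₁ (s, 2, d) = n₁ + R s := by
  simp [dictW]

/-- **THE EVENT UNIVERSE** of a slot born at `j`, cutoff `K`: events at steps `∈ (j, K]`, any kind, fatness class
`< Dcap K` (on the finite torus the linear size of a region at any scale `≤ K` is bounded in terms of `K`; the cap is
where that enters). [folklore] -/
def dictE (Dcap : ℕ → ℕ) (K j : ℕ) : Finset PEv :=
  (Ioc j K) ×ˢ ((Finset.univ : Finset (Fin 3)) ×ˢ Finset.range (Dcap K))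

/-- **THE BIRTH KINDS** of a slot born at `j`: `(j, 0, d′)`, `d′ < Dcap K`. [folklore] -/
def dictB (Dcap : ℕ → ℕ) (K j : ℕ) : Finset PEv :=
  ({j} : Finset ℕ) ×ˢ (({0} : Finset (Fin 3)) ×ˢ Finset.range (Dcap K))

/-- membership in the event universe [folklore] -/
theorem mem_dictE {Dcap : ℕ → ℕ} {K j : ℕ} {e : PEv} :
    e ∈ dictE Dcap K j ↔ e.step ∈ Ioc j K ∧ e.fat < Dcap K := by
  obtain ⟨s, k, d⟩ := e
  simp [dictE, PEv.step, PEv.fat]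

/-- membership in the birth kinds [folklore] -/
theorem mem_dictB {Dcap : ℕ → ℕ} {K j : ℕ} {e : PEv} :
    e ∈ dictB Dcap K j ↔ e.step = j ∧ e.kind = 0 ∧ e.fat < Dcap K := by
  obtain ⟨s, k, d⟩ := e
  simp only [dictB, PEv.step, PEv.kind, PEv.fat, Finset.mem_product, Finset.mem_singleton, Finset.mem_range]

/-- Universe events happen at steps `∈ (j, K]` (the binder `hE` of `slotDom_of_records`). [folklore] -/
theorem dictE_step (Dcap : ℕ → ℕ) (K j : ℕ) : ∀ e ∈ dictE Dcap K j, PEv.step e ∈ Ioc j K :=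
  fun _ he => (mem_dictE.1 he).1

/-- **NE7b CARRIER P1 ON THE DICTIONARY** (`T4PersistentHistoryCount.slotDom_of_records` with the event type, window
table, step map, event universe and birth kinds of the dictionary plugged in; its binder `hE` discharged): what remains
are the R4 cell count, the residual budgets `ρ̄`, `η̄`, the rate `Λ·e^{η̄ − κ₁} < 1`, the cut `j⋆`, and `hdom` — the
switch-off structure with slots labelled by (birth step, birth cell), PER-RECORD PRICES over
`records (dictW R n₁) (birth i) K (dictE Dcap K (birth i)) b` (by §2, `Gen.mem_records`, the record of a well-formed
pending genealogy IS such a record) and the single-slot ratio bound — i.e. exactly the WALL (E2-rel / R1: the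
context-uniform conditional price; cell GAPS G-ne7bp1-1), untouched. [folklore] -/
theorem slotDom_of_records_dict {ι γ : Type*} [DecidableEq ι] [DecidableEq γ] {l₀ : ℝ}
    {T : ℕ → Finset ι} {A : ℕ → ℝ → ι → ℝ} {Bad : ℕ → ℝ → Finset ι} (Cell : ℕ → ℕ → Finset γ) {V Λ : ℝ}
    (hV : 0 ≤ V) (hΛ : 0 ≤ Λ) (hcell : ∀ K a, ((Cell K a).card : ℝ) ≤ V * Λ ^ a) (R : ℕ → ℕ) (n₁ : ℕ)
    (Dcap : ℕ → ℕ) {κ₁ ρbar ηbar : ℝ} (hκ : 0 ≤ κ₁)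
    (ρ : PEv → ℝ) (hρ : ∀ K j, ∀ b ∈ dictB Dcap K j, 0 ≤ ρ b) (hρbar : ∀ K j, ∑ b ∈ dictB Dcap K j, ρ b ≤ ρbar)
    (η : PEv → ℝ) (hη : ∀ K j, ∀ e ∈ dictE Dcap K j, 0 ≤ η e)
    (hηbar : ∀ K j, ∀ t ∈ Ioc j K, ∑ e ∈ dictE Dcap K j with PEv.step e = t, η e ≤ ηbar)
    (hr : Λ * Real.exp (ηbar - κ₁) < 1) (jstar : ℕ → ℕ) (hj : ∀ K, jstar K ≤ K)
    (hdom : ∀ K t, |t| ≤ l₀ → ∃ (n : ℕ) (Φ : SwitchOff (T K) n) (birth : Fin n → ℕ) (cell : Fin n → γ)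
        (y : Fin n → PEv → Finset PEv → ℝ),
      Bad K t = Φ.bad ∧ (∀ i, birth i < jstar K) ∧ (∀ i, cell i ∈ Cell K (K - birth i)) ∧
      Function.Injective (fun i => (⟨birth i, cell i⟩ : Σ _ : ℕ, γ)) ∧
      (∀ i, ∀ b ∈ dictB Dcap K (birth i),
        ∀ Q ∈ records (dictW R n₁) (birth i) K (dictE Dcap K (birth i)) b, 0 ≤ y i b Q) ∧
      (∀ i, ∀ b ∈ dictB Dcap K (birth i), ∀ Q ∈ records (dictW R n₁) (birth i) K (dictE Dcap K (birth i)) b,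
        y i b Q ≤ ρ b * Real.exp (-(κ₁ * dictW R n₁ b)) *
          ∏ e ∈ Q, (Real.exp (-(κ₁ * dictW R n₁ e)) * η e)) ∧
      ∀ i : Fin n, ∀ τ'' ∈ T K, Φ.pend i τ'' = false →
        ∑ τ ∈ T K with (Φ.pend i τ = true ∧ Φ.off i τ = τ''), A K t τ ≤
          (∑ b ∈ dictB Dcap K (birth i),
            ∑ Q ∈ records (dictW R n₁) (birth i) K (dictE Dcap K (birth i)) b, y i b Q) * A K t τ'') :
    SlotDom l₀ T A Bad fun K => ρbar * Real.exp (-κ₁) * V *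
      ((Λ * Real.exp (ηbar - κ₁)) ^ (K - jstar K + 1) / (1 - Λ * Real.exp (ηbar - κ₁))) :=
  slotDom_of_records Cell hV hΛ hcell (dictW R n₁) PEv.step (dictE Dcap) (dictB Dcap) (dictE_step Dcap) hκ ρ hρ
    hρbar η hη hηbar hr jstar hj hdom

/-- **NE7b CARRIER P2 ON THE DICTIONARY — the window side.**  `T4PersistenceRenewal`'s first-step pairing kernel
`pairKernel q W s ℓ = q (s − ℓ)·1_{ℓ ≤ W (s − ℓ)}` indexes the window by the POSITION `s − ℓ` of the event that opened
the gap; on the dictionary that is the placed window of the event in force, and §2 (`Gen.renew_lag_le`,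
`Gen.merge_place_eq`) says the lag of the next event never exceeds it — so the kernel entry met along a genealogy is the
live one, `q` of the opening event: [folklore] -/
theorem pairKernel_live (q : ℕ → ℝ) (Wpos : ℕ → ℕ) {s a : ℕ} (ha : a ≤ s) (hlag : s - a ≤ Wpos a) :
    pairKernel q Wpos s (s - a) = q a := by
  unfold pairKernel
  rw [Nat.sub_sub_self ha, if_pos hlag]

/-- … instantiated on a renewal AT READINESS (the printed timing: «Z₀ satisfies the conditions (i), (ii), and a new
large field was introduced in the preparatory operations» p. 385–386, i.e. `h + 1 = reach G`): with `Wpos` the window of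
the event placed at each position (`Wpos (place top) = W top`), the kernel entry at the renewal step `h + 1` and lag
`h + 1 − place top` (`= W top`) is the live one, `q (place top)`. [folklore] -/
theorem pairKernel_live_renew {ε : Type*} [DecidableEq ε] (q : ℕ → ℝ) (W : ε → ℕ) (Wpos : ℕ → ℕ) (G : Gen ε)
    {h : ℕ} (hready : h + 1 = G.reach W) (hpos : Wpos (G.place W G.top) = W G.top) :
    pairKernel q Wpos (h + 1) (h + 1 - G.place W G.top) = q (G.place W G.top) := by
  rw [G.reach_eq_place_top W] at hready
  exact pairKernel_live q Wpos (by omega) (by rw [hpos]; omega)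

/-- **BOTH CARRIERS LAND IN THE SAME OUTPUT SHAPE ON THE SAME RUN DATA** (the two `example`s the carved row asks for):
the P1 chain `slotDom_of_records_dict` (both runs) ⇒ `relWeightBound_of_slotDom_twoRate` with rate
`r = Λ·e^{η̄ − κ₁}` and constant `ρ̄·e^{−κ₁}` … [folklore] -/
example {ι : Type*} [DecidableEq ι] {l₀ : ℝ} {T : ℕ → Finset ι} {A B : ℕ → ℝ → ι → ℝ} {Bad : ℕ → ℝ → Finset ι}
    {V Λ κ₁ ρbar ηbar c : ℝ} {jstar : ℕ → ℕ} (hρbar : 0 ≤ ρbar) (hV : 0 ≤ V)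
    (h0 : 0 < Λ * Real.exp (ηbar - κ₁)) (hr : Λ * Real.exp (ηbar - κ₁) < 1) (hc : 0 < c)
    (hfrac : ∀ K : ℕ, c * K ≤ ((K - jstar K : ℕ) : ℝ))
    (hA : ∀ K t, |t| ≤ l₀ → ∀ τ ∈ T K, 0 ≤ A K t τ) (hB : ∀ K t, |t| ≤ l₀ → ∀ τ ∈ T K, 0 ≤ B K t τ)
    (hDA : SlotDom l₀ T A Bad fun K => ρbar * Real.exp (-κ₁) * V *
      ((Λ * Real.exp (ηbar - κ₁)) ^ (K - jstar K + 1) / (1 - Λ * Real.exp (ηbar - κ₁))))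
    (hDB : SlotDom l₀ T B Bad fun K => ρbar * Real.exp (-κ₁) * V *
      ((Λ * Real.exp (ηbar - κ₁)) ^ (K - jstar K + 1) / (1 - Λ * Real.exp (ηbar - κ₁)))) :
    RelWeightBound l₀ T A B Bad fun K => 1 - Real.exp (-(ρbar * Real.exp (-κ₁) * V *
      ((Λ * Real.exp (ηbar - κ₁)) ^ (K - jstar K + 1) / (1 - Λ * Real.exp (ηbar - κ₁))))) :=
  relWeightBound_of_slotDom_twoRate (mul_nonneg hρbar (Real.exp_nonneg _)) hV h0 hr hc hfrac hA hB hDA hDB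

/-- … and the P2 chain `EventDom` (both runs, tilt `Λ < z`) ⇒ `relWeightBound_of_eventDom` with rate `Λ·z⁻¹` and
constant `B₀·D/η` — the same `T4WeightBudget.RelWeightBound` shape `1 − exp(−C·V·r^{K − j⋆K + 1}/(1 − r))` over the
same R4 constants `V`, `Λ` and cut `j⋆`; the dictionary feeds P1 through `records (dictW R n₁) …` and P2 through the
placed windows (`pairKernel`, `ForestWitness.dom_of_pairing`). [folklore] -/
example {ι : Type*} [DecidableEq ι] {l₀ : ℝ} {T : ℕ → Finset ι} {A B : ℕ → ℝ → ι → ℝ} {Bad : ℕ → ℝ → Finset ι}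
    {z η B₀ D V Λ c : ℝ} {jstar : ℕ → ℕ} (hη : 0 < η) (hB₀ : 0 ≤ B₀) (hD : 0 ≤ D) (hV : 0 ≤ V) (hΛ : 0 < Λ)
    (hzΛ : Λ < z) (hc : 0 < c) (hj : ∀ K, jstar K ≤ K) (hfrac : ∀ K : ℕ, c * K ≤ ((K - jstar K : ℕ) : ℝ))
    (hA : ∀ K t, |t| ≤ l₀ → ∀ τ ∈ T K, 0 ≤ A K t τ) (hB : ∀ K t, |t| ≤ l₀ → ∀ τ ∈ T K, 0 ≤ B K t τ)
    (hEA : EventDom l₀ T A Bad z η B₀ D V Λ jstar) (hEB : EventDom l₀ T B Bad z η B₀ D V Λ jstar) :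
    RelWeightBound l₀ T A B Bad fun K =>
      1 - Real.exp (-(B₀ * D / η * V * ((Λ * z⁻¹) ^ (K - jstar K + 1) / (1 - Λ * z⁻¹)))) :=
  relWeightBound_of_eventDom hη hB₀ hD hV hΛ hzΛ hc hj hfrac hA hB hEA hEB

end Dictionary

/-! ## §4 Sanity: a merged genealogy on the window table, decided -/

section Sanity

/-- Event ids `0, 1, 2`: `0` = the root birth at step `0` (window `3`: reach `3`), `1` = the partner's birth at step `1`
(window `4`: reach `5`), `2` = their merger (window `2`, deferred to the later reach `5`: reach `7`). [folklore] -/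
def W₀ : ℕ → ℕ := fun e => if e = 0 then 3 else if e = 1 then 4 else 2

/-- The merged genealogy `merge (born 0 0) (born 1 1) 2`. [folklore] -/
def G₀ : Gen ℕ := Gen.merge (Gen.born 0 0) (Gen.born 1 1) 2

example : G₀.reach W₀ = 7 := by decide
example : G₀.rootStep = 0 := by decide
example : G₀.root = 0 := by decide
example : G₀.events = {2, 0, 1} := by decide
example : G₀.place W₀ 2 = 5 := by decide

/-- It is well formed: distinct events, and the two lives `[0, 3)`, `[1, 5)` overlap. [folklore] -/
theorem G₀_wf : G₀.WF W₀ := by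
  simp [G₀, Gen.WF, W₀, Gen.events, Gen.rootStep, Gen.reach]

/-- Pending at `K = 6 < 7`: the cover theorem applies … -/
example : Covers W₀ G₀.rootStep 6 G₀.root (G₀.events.erase G₀.root) (G₀.place W₀) := Gen.covers G₀_wf (by decide)

/-- … and agrees with the decided literal statement: windows `[0,3) ∪ [1,5) ∪ [5,7) ⊇ [0,6]`, span `7 ≤ 3 + (4 + 2)`. -/
example : Covers W₀ 0 6 0 {1, 2} (G₀.place W₀) := by decide

example : SpanLE W₀ 0 6 0 {1, 2} := by decide

/-- THE MERGER GAP, decided: the root constituent's OWN events (birth `0` + merger `2`, windows `3 + 2`) do NOT span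
the life `[0, 6]` — the steps `[3, 5)` are paid by the partner's birth window, exactly as (1.88) p. 387 charges them to
`κ_{j+1}(Y)`; a single-constituent record is not a record of the pending slot, the genealogy is. -/
example : ¬ SpanLE W₀ 0 6 0 {2} := by decide

/-- Immediate placement of the merger window (at its step `2`) would NOT cover either (`[0,3) ∪ [1,5) ∪ [2,4) ∌ 5`). -/
example : ¬ Covers W₀ 0 6 0 {1, 2} (fun e => if e = 0 then 0 else if e = 1 then 1 else 2) := by decide

/-- The window table on sample events (`R ≡ 5`, `n₁ = 9`): a birth of fatness `12` at step `3` waits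
`max 1 ⌊log₂ 12⌋ = 3` fat steps, window `3 + 5 + 1`; a renewal `5 + 1`; a merger `9 + 5`. -/
example : dictW (fun _ => 5) 9 (3, 0, 12) = 9 ∧ dictW (fun _ => 5) 9 (4, 1, 0) = 6 ∧
    dictW (fun _ => 5) 9 (4, 2, 0) = 14 := by decide

example : ((7, 1, 3) : PEv) ∈ dictE (fun _ => 4) 9 2 ∧ ((2, 1, 3) : PEv) ∉ dictE (fun _ => 4) 9 2 ∧
    ((2, 0, 3) : PEv) ∈ dictB (fun _ => 4) 9 2 := by decide

end Sanity

end Literature.MathematicalPhysics.QuantumFieldTheory.Balaban1983to89.T4PersistenceDictionary
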